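import Summits.BirchSwinnertonDyer.Rank1Residual.X5.TwoAdicMuZeroUpgrade
import Summits.BirchSwinnertonDyer.Rank1Residual.X5.TwoAdicTargetsAlpha
import Summits.BirchSwinnertonDyer.Rank1Residual.Additive.TameBranchLambdaParityLaw
import HarnessLib

/-!
# The `λ` + constant-term pinch in `Λ = ℤ_p⟦T⟧` and the `2`-adic main conjecture at every member of
# an isogeny class (route ByReductionTypeAtTwo, crux `GoodOrdinaryRankZeroAtTwo`; seat bsd-2adic-ord)

The cell's pinch (`X1.MuLambda.span_eq_span_iff_mu_lam`, Greenberg–Vatsal p. 4) needs an INTEGRAL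
divisibility `g' = g·h` plus `μ(g') = μ(g)`, `λ(g') = λ(g)`. At a good ordinary `2` the integral
divisibility is exactly what is missing off the `μ = 0` locus (Kato 17.4 (3) prints `p ≠ 2`; 17.4 (1)(2)
gives `p^k·g' ∈ (g)` only). §§1–2: a RATIONAL divisibility `C c₂·g' = C c₁·a·g`, `λ(g') = λ(g)` and
`‖g'(0)‖ = ‖g(0)‖ ≠ 0` force `(g') = (g)` — no `μ`-input (`span_eq_span_of_lamConstPinch`). §3: hence
`char_Λ X = (ϖ·L₂)` at a cyclotomic datum from Kato 17.4 (1)(2)@2 + `λ`-match + constant-term match.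
§4: at analytic rank `0` the constant-term match IS `BSD(E,2)` (Greenberg Thm. 4.1 at `2` +
interpolation), so `BSD₂` + `λ`-match ⇒ the main conjecture at the datum — at EVERY member of an α-go
class (λ is a ℚ-isogeny invariant, `X2.IsogenyLambdaInvariant`; `BSD₂` is Cassels-invariant), in
particular at Greenberg's Prop-5.13 members (`μ ≥ 1`), which no `μ = 0` certificate reaches
(`X5/KatoOrdTwoTowerGapIff.lean`). PUBLISHED inputs enter as hypotheses; nothing asserted; no named fact.

References: L. Washington, *Introduction to Cyclotomic Fields*, §7.1; R. Greenberg, V. Vatsal,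
Invent. Math. 142 (2000), p. 4; K. Kato, Astérisque 295 (2004), Thm. 17.4; R. Greenberg, LNM 1716
(1999), Thm. 4.1; B. Mazur, J. Tate, J. Teitelbaum, Invent. Math. 84 (1986), §I.14.
-/

set_option autoImplicit false

noncomputable section

open scoped Classical MatrixGroups ModularForm

open CongruenceSubgroup WeierstrassCurve Literature.NumberTheory.EllipticCurves
  Literature.NumberTheory.EllipticCurves.ModularForms Literature.NumberTheory.EllipticCurves.Rank1Residual
  Literature.NumberTheory.EllipticCurves.Rank1Residual.Typed
  Summit.BirchSwinnertonDyer.Rank1Residual.X1.MuLambda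
  Summit.BirchSwinnertonDyer.Rank1Residual.X1.ParitySqueeze

namespace Summit.BirchSwinnertonDyer.BirchSwinnertonDyer.Theorems.LambdaConstPinch

variable {p : ℕ} [Fact p.Prime]

/-! ## §1 `μ`, `λ`, `pfree` of constants (`isUnit_pfree_of_lam_eq_zero` is reused from `Additive`) -/

/-- The reduction mod `p` of a constant `C u` with `u ∈ ℤ_pˣ` is non-zero. [folklore] -/
theorem red_C_units_ne_zero (u : ℤ_[p]ˣ) : red (PowerSeries.C ((u : ℤ_[p])) : IwasawaAlgebra p) ≠ 0 := by
  intro h0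
  have h1 := congrArg (PowerSeries.coeff 0) h0
  rw [red, PowerSeries.coeff_map, PowerSeries.coeff_zero_C, map_zero,
    IsLocalRing.residue_eq_zero_iff] at h1
  exact (IsLocalRing.mem_maximalIdeal _).mp h1 (Units.isUnit u)

/-- A non-zero constant of `Λ`: `C c = C(p^{v(c)}) · C u` (`u = unitCoeff c ∈ ℤ_pˣ`), hence
`μ(C c) = v(c)` and `pfree (C c) = C u`. [folklore] -/
theorem mu_C_and_pfree_C {c : ℤ_[p]} (hc : c ≠ 0) :
    mu (PowerSeries.C c : IwasawaAlgebra p) = c.valuation ∧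
      pfree (PowerSeries.C c : IwasawaAlgebra p) = PowerSeries.C ((PadicInt.unitCoeff hc : ℤ_[p])) := by
  refine mu_eq_and_pfree_eq (red_C_units_ne_zero _) ?_
  rw [← map_mul]
  congr 1
  rw [mul_comm]
  exact PadicInt.unitCoeff_spec hc

/-- `λ(C c) = 0` for a non-zero constant `c ∈ ℤ_p`. [folklore] -/
theorem lam_C {c : ℤ_[p]} (hc : c ≠ 0) : lam (PowerSeries.C c : IwasawaAlgebra p) = 0 := by
  rw [lam, (mu_C_and_pfree_C hc).2]
  have hne : PowerSeries.coeff 0 (red (PowerSeries.C ((PadicInt.unitCoeff hc : ℤ_[p])) :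
      IwasawaAlgebra p)) ≠ 0 := by
    rw [red, PowerSeries.coeff_map, PowerSeries.coeff_zero_C, Ne, IsLocalRing.residue_eq_zero_iff]
    exact fun hm => (IsLocalRing.mem_maximalIdeal _).mp hm (Units.isUnit _)
  have hle := PowerSeries.order_le 0 hne
  have h0 : (red (PowerSeries.C ((PadicInt.unitCoeff hc : ℤ_[p])) : IwasawaAlgebra p)).order = 0 :=
    nonpos_iff_eq_zero.mp hle
  rw [h0]
  rfl

/-- Two non-zero `p`-adic integers with the same norm are associated. [folklore] -/
theorem exists_units_mul_eq_of_norm_eq {x y : ℤ_[p]} (hx : x ≠ 0) (hy : y ≠ 0) (h : ‖x‖ = ‖y‖) :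
    ∃ w : ℤ_[p]ˣ, x = y * w := by
  obtain ⟨ux, vx, ex⟩ : ∃ (u : ℤ_[p]ˣ) (v : ℕ), x = (u : ℤ_[p]) * (p : ℤ_[p]) ^ v :=
    ⟨_, _, PadicInt.unitCoeff_spec hx⟩
  obtain ⟨uy, vy, ey⟩ : ∃ (u : ℤ_[p]ˣ) (v : ℕ), y = (u : ℤ_[p]) * (p : ℤ_[p]) ^ v :=
    ⟨_, _, PadicInt.unitCoeff_spec hy⟩
  have hnx : ‖x‖ = (p : ℝ) ^ (-(vx : ℤ)) := by
    rw [ex, norm_mul, PadicInt.isUnit_iff.mp (Units.isUnit ux), one_mul, PadicInt.norm_p_pow]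
  have hny : ‖y‖ = (p : ℝ) ^ (-(vy : ℤ)) := by
    rw [ey, norm_mul, PadicInt.isUnit_iff.mp (Units.isUnit uy), one_mul, PadicInt.norm_p_pow]
  have hv : vx = vy := by
    rw [hnx, hny] at h
    have hp1 : (1 : ℝ) < p := by exact_mod_cast (Fact.out : p.Prime).one_lt
    have := zpow_right_injective₀ (zero_lt_one.trans hp1) hp1.ne' h
    exact_mod_cast neg_inj.mp this
  refine ⟨uy⁻¹ * ux, ?_⟩
  rw [ex, ey, hv, Units.val_mul]
  calc (ux : ℤ_[p]) * (p : ℤ_[p]) ^ vy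
      = ((uy : ℤ_[p]) * ((uy⁻¹ : ℤ_[p]ˣ) : ℤ_[p])) * ((ux : ℤ_[p]) * (p : ℤ_[p]) ^ vy) := by
        rw [Units.mul_inv, one_mul]
    _ = (uy : ℤ_[p]) * (p : ℤ_[p]) ^ vy * (((uy⁻¹ : ℤ_[p]ˣ) : ℤ_[p]) * (ux : ℤ_[p])) := by ring

/-! ## §2 The pinch -/

/-- **The `λ` + constant-term pinch.** Let `g, g' ∈ Λ = ℤ_p⟦T⟧` be non-zero with a RATIONAL
divisibility `C c₂ · g' = C c₁ · a · g` (`c₁, c₂ ∈ ℤ_p` non-zero, `a ∈ Λ`), equal `λ`-invariants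
`λ(g') = λ(g)`, `g(0) ≠ 0` and `‖g'(0)‖ = ‖g(0)‖`. Then `(g') = (g)`. Proof: `λ` is additive and
vanishes on non-zero constants, so `λ(a) = 0` and `a = p^{μ(a)}·u` with `u ∈ Λˣ`; comparing the norms
of the constant terms gives `‖c₂‖ = ‖c₁ p^{μ(a)}‖`, so `c₁ p^{μ(a)} = c₂ w` with `w ∈ ℤ_pˣ`, and
cancelling `C c₂` in the domain `Λ` leaves `g' = (C w · u) · g`. [cite: Washington1997, §7.1]
[cite: GreenbergVatsal2000, p. 4 (after Thm. (1.2))] -/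
theorem span_eq_span_of_lamConstPinch {g g' a : IwasawaAlgebra p} {c₁ c₂ : ℤ_[p]}
    (hg : g ≠ 0) (hg' : g' ≠ 0) (hc₁ : c₁ ≠ 0) (hc₂ : c₂ ≠ 0)
    (hfac : PowerSeries.C c₂ * g' = PowerSeries.C c₁ * a * g)
    (hlam : lam g' = lam g) (h0 : PowerSeries.constantCoeff g ≠ 0)
    (hnorm : ‖PowerSeries.constantCoeff g'‖ = ‖PowerSeries.constantCoeff g‖) :
    Ideal.span ({g'} : Set (IwasawaAlgebra p)) = Ideal.span {g} := by
  have hC₁ : (PowerSeries.C c₁ : IwasawaAlgebra p) ≠ 0 := by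
    rw [Ne, ← map_zero (PowerSeries.C (R := ℤ_[p])), PowerSeries.C_injective.eq_iff]; exact hc₁
  have hC₂ : (PowerSeries.C c₂ : IwasawaAlgebra p) ≠ 0 := by
    rw [Ne, ← map_zero (PowerSeries.C (R := ℤ_[p])), PowerSeries.C_injective.eq_iff]; exact hc₂
  have ha : a ≠ 0 := by
    rintro rfl
    rw [mul_zero, zero_mul] at hfac
    exact (mul_ne_zero hC₂ hg') hfac
  have hlamA : lam a = 0 := by
    have h1 : lam (PowerSeries.C c₂ * g') = lam (PowerSeries.C c₁ * a * g) := by rw [hfac]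
    rw [lam_mul hC₂ hg', lam_mul (mul_ne_zero hC₁ ha) hg, lam_mul hC₁ ha, lam_C hc₁, lam_C hc₂,
      hlam] at h1
    omega
  have hu : IsUnit (pfree a) :=
    Summit.BirchSwinnertonDyer.Rank1Residual.Additive.TameBranchLambdaParity.isUnit_pfree_of_lam_eq_zero
      ha hlamA
  have hadec : a = PowerSeries.C ((p : ℤ_[p]) ^ mu a) * pfree a := eq_C_pow_mu_mul_pfree a
  have hu0 : IsUnit (PowerSeries.constantCoeff (pfree a)) := PowerSeries.isUnit_iff_constantCoeff.mp hu
  have hconst : c₂ * PowerSeries.constantCoeff g' =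
      c₁ * (p : ℤ_[p]) ^ mu a * PowerSeries.constantCoeff (pfree a) * PowerSeries.constantCoeff g := by
    have := congrArg PowerSeries.constantCoeff hfac
    rw [hadec] at this
    simp only [map_mul, PowerSeries.constantCoeff_C] at this
    rw [this]; ring
  have hg'0 : PowerSeries.constantCoeff g' ≠ 0 := by
    intro h
    rw [h, norm_zero] at hnorm
    exact h0 (norm_eq_zero.mp hnorm.symm)
  have hnorm' : ‖c₂‖ = ‖c₁ * (p : ℤ_[p]) ^ mu a‖ := by
    have h1 := congrArg (fun z : ℤ_[p] => ‖z‖) hconst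
    simp only [norm_mul] at h1
    rw [PadicInt.isUnit_iff.mp hu0, mul_one, hnorm] at h1
    have hpos : 0 < ‖PowerSeries.constantCoeff g‖ := norm_pos_iff.mpr h0
    have h2 : ‖c₂‖ = ‖c₁‖ * ‖(p : ℤ_[p]) ^ mu a‖ := mul_right_cancel₀ hpos.ne' (by rw [h1])
    rw [h2, norm_mul]
  have hcp : c₁ * (p : ℤ_[p]) ^ mu a ≠ 0 :=
    mul_ne_zero hc₁ (pow_ne_zero _ (by exact_mod_cast (Fact.out : p.Prime).ne_zero))
  obtain ⟨w, hw⟩ := exists_units_mul_eq_of_norm_eq hcp hc₂ hnorm'.symm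
  have hunit : IsUnit (PowerSeries.C ((w : ℤ_[p])) * pfree a : IwasawaAlgebra p) :=
    ((Units.isUnit w).map PowerSeries.C).mul hu
  have hCC : (PowerSeries.C c₁ : IwasawaAlgebra p) * PowerSeries.C ((p : ℤ_[p]) ^ mu a) =
      PowerSeries.C c₂ * PowerSeries.C ((w : ℤ_[p])) := by
    rw [← map_mul, ← map_mul, hw]
  have hfac' : PowerSeries.C c₂ * g' =
      PowerSeries.C c₂ * ((PowerSeries.C ((w : ℤ_[p])) * pfree a) * g) := by
    calc PowerSeries.C c₂ * g' = PowerSeries.C c₁ * a * g := hfac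
      _ = PowerSeries.C c₁ * (PowerSeries.C ((p : ℤ_[p]) ^ mu a) * pfree a) * g :=
          congrArg (fun t => PowerSeries.C c₁ * t * g) hadec
      _ = (PowerSeries.C c₁ * PowerSeries.C ((p : ℤ_[p]) ^ mu a)) * pfree a * g := by ring
      _ = (PowerSeries.C c₂ * PowerSeries.C ((w : ℤ_[p]))) * pfree a * g := by rw [hCC]
      _ = PowerSeries.C c₂ * ((PowerSeries.C ((w : ℤ_[p])) * pfree a) * g) := by ring
  have hg'eq : g' = (PowerSeries.C ((w : ℤ_[p])) * pfree a) * g := mul_left_cancel₀ hC₂ hfac'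
  rw [hg'eq, mul_comm]
  exact Ideal.span_singleton_eq_span_singleton.mpr (associated_mul_unit_right g _ hunit).symm


/-! ## §3 The main conjecture at a datum from Kato 17.4 (1)(2) + `λ`-match + constant-term match -/

section Curve

variable (W : WeierstrassCurve ℚ) [W.IsElliptic] [W.IsGloballyMinimal]
  {N : ℕ} [NeZero N] {f : CuspForm (Gamma0 N) 2}

omit [W.IsElliptic] in
/-- **`char_Λ X(E/ℚ_∞) = (ϖ·L₂(f,α))` at a cyclotomic datum from the RATIONAL Kato divisibility, a
`λ`-match and a constant-term match — no `μ = 0` input.** `W` good ordinary at `2`, `f` its newform,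
`κ, γ` cyclotomic, `D` a dual datum with `char_Λ X = (f_E)`, `ι L₀ = ϖ·L₂(f,α)` (`ϖ ∈ ℚ^×`);
PUBLISHED input Kato 2004 Thm. 17.4 (1)(2) at `2` (`kato_divisibility_allPrimes W 2`:
`(num ϖ·a)·f_E = 2ⁿ·(den ϖ·L₀)`). If `λ(L₀) = λ(f_E)` and `‖L₀(0)‖ = ‖f_E(0)‖ ≠ 0` then `X` is torsion
and `char_Λ X = (L₀)` (§2). [cite: Kato2004Asterisque, Thm. 17.4 (1)(2) (p. 273)]
[cite: GreenbergVatsal2000, p. 4 (after Thm. (1.2))] -/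
theorem charIdeal_eq_span_of_kato_of_lam_eq_of_norm_constantCoeff_eq
    (h17 : kato_divisibility_allPrimes W 2 (f := f))
    {κ : ZpExtension ℚ 2} {γ : Field.absoluteGaloisGroup ℚ}
    (hκ : κ.IsCyclotomic) (hγ : κ.IsTopGenerator γ) (hγ' : IsCyclotomicVariable 2 γ)
    (hord : IsOrdinaryAt W 2) (hf : IsNewformOf W f) (D : W.SelmerDualData κ γ)
    {fE : IwasawaAlgebra 2} (hchar : D.charIdeal = Ideal.span {fE})
    {ϖ : ℚ} (hϖ0 : ϖ ≠ 0) {L₀ : IwasawaAlgebra 2}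
    (hL₀ : iwasawaToPowerSeries 2 L₀ =
      PowerSeries.C (ϖ : ℚ_[2]) * padicLFunction f (unitRoot W 2 : ℚ_[2]))
    (hlam : lam L₀ = lam fE) (h0 : PowerSeries.constantCoeff fE ≠ 0)
    (hnorm : ‖PowerSeries.constantCoeff L₀‖ = ‖PowerSeries.constantCoeff fE‖) :
    D.IsTorsion ∧ D.charIdeal = Ideal.span {L₀} := by
  obtain ⟨hX, a, n, hrel⟩ :=
    Summit.BirchSwinnertonDyer.Rank1Residual.X5.O1.MuZeroUpgrade.exists_mul_charGen_eq_of_kato_allPrimes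
      W 2 h17 hκ hγ hγ' hord hf D hchar hL₀
  refine ⟨hX, ?_⟩
  have hfE0 : fE ≠ 0 := fun h => h0 (by rw [h, map_zero])
  have hL₀0 : L₀ ≠ 0 := by
    intro h
    rw [h, map_zero, norm_zero] at hnorm
    exact h0 (norm_eq_zero.mp hnorm.symm)
  have hc₁ : (ϖ.num : ℤ_[2]) ≠ 0 := by exact_mod_cast Rat.num_ne_zero.mpr hϖ0
  have hc₂ : ((2 : ℕ) : ℤ_[2]) ^ n * (ϖ.den : ℤ_[2]) ≠ 0 :=
    mul_ne_zero (pow_ne_zero _ (by exact_mod_cast (two_ne_zero : (2 : ℕ) ≠ 0)))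
      (by exact_mod_cast ϖ.den_nz)
  have hfac : PowerSeries.C (((2 : ℕ) : ℤ_[2]) ^ n * (ϖ.den : ℤ_[2])) * L₀ =
      PowerSeries.C (ϖ.num : ℤ_[2]) * a * fE := by
    rw [map_mul, mul_assoc, ← hrel]
  rw [hchar]
  exact (span_eq_span_of_lamConstPinch hfE0 hL₀0 hc₁ hc₂ hfac hlam h0 hnorm).symm


/-! ## §4 Analytic rank `0`: the constant-term match IS `BSD(E,2)` (Greenberg Thm. 4.1 at `2`) -/

/-- **The `2`-adic main conjecture at a cyclotomic datum of a rank-`0` good-ordinary-at-`2` curve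
from `BSD(E,2)` and a `λ`-match — no `μ`-input, no integral divisibility.** `W` globally minimal,
good ordinary at `2`, `L(E,1) ≠ 0`, `Ш` finite; PUBLISHED inputs as hypotheses: Kato 17.4 (1)(2) at `2`
(`h17`), Greenberg 1999 Thm. 4.1 at `2` (`hEC`); the Néron-normalised `L`-function is integral
(`ι L₀ = ϖ·L₂(f,α)`, `ϖ·Ω_E = Ω⁺_f`); the `λ`-MATCH `λ(L₀) = λ(X)`; and `BSD(E,2)` as the EQUALITY
`ord₂(L(E,1)/Ω_E) = ord₂ #Ш + ord₂ ∏c_ℓ − 2·ord₂ #E(ℚ)_tors` (`hbsd`). Then `X` is torsion and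
`char_Λ X = (L₀)`: interpolation (`L₀(0) = ϖ(1 − α⁻¹)²[0]⁺_f`), `1 − α⁻¹ ~ #Ẽ(𝔽₂)(2)`, Thm. 4.1
(`f_E(0)·#E(ℚ)(2)² ~ 2^{ord₂∏c}·#Ẽ(𝔽₂)(2)²·#Sel`) and `hbsd` give `‖L₀(0)‖ = ‖f_E(0)‖ ≠ 0`; conclude
by §3. USE: the main conjecture at EVERY member of an α-go class (in particular the Prop-5.13
members) from the class's `BSD₂` + one member's `λ`-pinch + `λ`-invariance under isogeny.
[cite: Kato2004Asterisque, Thm. 17.4 (1)(2) (p. 273)] [cite: GreenbergLNM1716, Thm. 4.1 (p. 102)]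
[cite: MazurTateTeitelbaum1986Invent, §I.14 (14.3)] [cite: GreenbergVatsal2000, p. 4 (after Thm. (1.2))] -/
theorem charIdeal_eq_span_of_kato_of_lam_eq_of_bsd
    (hEC : Summit.BirchSwinnertonDyer.Rank1Residual.X5.O1.TwoAdicEulerCharRankZero W 0)
    (hord : IsOrdinaryAt W 2) (hL : W.entireLFunction 1 ≠ 0) (hfin : Finite W.sha)
    (h17 : kato_divisibility_allPrimes W 2 (f := f))
    {κ : ZpExtension ℚ 2} {γ : Field.absoluteGaloisGroup ℚ}
    (hκ : κ.IsCyclotomic) (hγ : κ.IsTopGenerator γ) (hγ' : IsCyclotomicVariable 2 γ)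
    (hf : IsNewformOf W f) (D : W.SelmerDualData κ γ) {ϖ : ℚ}
    (hϖ : (ϖ : ℝ) * W.realPeriodRat = plusPeriod f) {L₀ : IwasawaAlgebra 2}
    (hL₀ : iwasawaToPowerSeries 2 L₀ =
      PowerSeries.C (ϖ : ℚ_[2]) * padicLFunction f (unitRoot W 2 : ℚ_[2]))
    (hlam : lam L₀ = D.lambda)
    (hbsd : ∀ t : ℚ, W.entireLFunction 1 / (W.realPeriodRat : ℂ) = (t : ℂ) →
      padicValRat 2 t = (padicValNat 2 W.shaOrder : ℤ) + padicValNat 2 W.tamagawaProduct -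
        2 * padicValNat 2 W.torsionOrder) :
    D.IsTorsion ∧ D.charIdeal = Ideal.span {L₀} := by
  -- Step 0: `ϖ ≠ 0`; `s = [0]⁺_f`, `t = ϖ·s = L(E,1)/Ω_E ≠ 0`
  have hΩpos : 0 < W.realPeriodRat := W.realPeriodRat_pos_holds
  have hϖ0 : ϖ ≠ 0 := by
    rintro rfl
    have hper : 0 < plusPeriod f := IsNewform0.plusPeriod_pos_holds hf.1 hf.coeffField_eq_bot
    rw [← hϖ, Rat.cast_zero, zero_mul] at hper
    exact lt_irrefl _ hper
  set s : ℚ := ratPlusSymbol f 0 with hs_def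
  set t : ℚ := ϖ * s with ht_def
  have hLval : W.entireLFunction 1 = (((s : ℝ) * plusPeriod f : ℝ) : ℂ) := hf.entireLFunction_one_eq
  have hq : W.entireLFunction 1 / (W.realPeriodRat : ℂ) = ((t : ℚ) : ℂ) := by
    rw [hLval, ← hϖ, div_eq_iff (Complex.ofReal_ne_zero.mpr hΩpos.ne'), ht_def]
    push_cast
    ring
  have hs0 : s ≠ 0 := by
    intro h0
    apply hL
    rw [hLval, h0]
    simp
  have hvt : padicValRat 2 t = padicValRat 2 ϖ + padicValRat 2 s := by
    rw [ht_def, padicValRat.mul hϖ0 hs0]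
  have hbsd' := hbsd t hq
  -- Step 1: the Iwasawa module, a generator `fE` of `char_Λ X`, Kato's rational relation
  haveI : Module.Finite (IwasawaAlgebra 2) D.X := D.module_finite_holds hγ
  obtain ⟨fE, hfE⟩ := (charIdeal_isPrincipal_holds 2 D.X).principal
  have hchar : D.charIdeal = Ideal.span {fE} := hfE
  obtain ⟨hX, b, n, hrel⟩ :=
    Summit.BirchSwinnertonDyer.Rank1Residual.X5.O1.MuZeroUpgrade.exists_mul_charGen_eq_of_kato_allPrimes
      W 2 h17 hκ hγ hγ' hord hf D hchar hL₀
  -- Step 2 (interpolation): `L₀(0) = ϖ · (1 - α⁻¹)² · s`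
  set a : ℚ_[2] := ((unitRoot W 2 : ℤ_[2]) : ℚ_[2]) with ha
  have hL0 : ((PowerSeries.constantCoeff L₀ : ℤ_[2]) : ℚ_[2]) =
      (ϖ : ℚ_[2]) * (1 - a⁻¹) ^ 2 * (s : ℚ_[2]) := by
    rw [← constantCoeff_iwasawaToPowerSeries 2 L₀, hL₀, map_mul, PowerSeries.constantCoeff_C,
      constantCoeff_padicLFunction_unitRoot hord hf]
    ring
  obtain ⟨u₂, hu₂⟩ := exists_unit_one_sub_unitRoot_inv 2 W hord
  haveI : NeZero (2 : ℕ) := ⟨two_ne_zero⟩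
  obtain ⟨u₃, hu₃⟩ := exists_unit_natCard_eq_mul_card_primaryComponent
    ((integralModelInt W).map (Int.castRingHom (ZMod 2))).toAffine.Point 2
  set Np : ℚ_[2] := (Nat.card (AddCommGroup.primaryComponent
    ((integralModelInt W).map (Int.castRingHom (ZMod 2))).toAffine.Point 2) : ℚ_[2]) with hNp
  have hNcount : (W.reductionPointCount 2 : ℚ_[2]) = ((u₃ : ℤ_[2]) : ℚ_[2]) * Np := by
    rw [WeierstrassCurve.reductionPointCount, hNp]
    exact hu₃
  have hNp0 : Np ≠ 0 := by
    rw [hNp]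
    exact_mod_cast Nat.card_pos.ne'
  have h1 : (1 - a⁻¹) = ((u₂ : ℤ_[2]) : ℚ_[2]) * ((u₃ : ℤ_[2]) : ℚ_[2]) * Np := by
    rw [hu₂, hNcount, mul_assoc]
  have hsQ0 : (s : ℚ_[2]) ≠ 0 := by exact_mod_cast hs0
  have hϖQ0 : (ϖ : ℚ_[2]) ≠ 0 := by exact_mod_cast hϖ0
  have hU0 : ((u₂ : ℤ_[2]) : ℚ_[2]) * ((u₃ : ℤ_[2]) : ℚ_[2]) ≠ 0 :=
    mul_ne_zero (coe_units_ne_zero 2 u₂) (coe_units_ne_zero 2 u₃)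
  have h20 : (2 : ℚ_[2]) ≠ 0 := two_ne_zero
  -- Step 3 (finiteness): `L₀(0) ≠ 0`, hence `fE(0) ≠ 0` (Kato's relation), `Sel_{2^∞}(E/ℚ)` finite
  have hL0Q0 : ((PowerSeries.constantCoeff L₀ : ℤ_[2]) : ℚ_[2]) ≠ 0 := by
    rw [hL0, h1]
    exact mul_ne_zero (mul_ne_zero hϖQ0 (pow_ne_zero 2 (mul_ne_zero hU0 hNp0))) hsQ0
  have hL00 : PowerSeries.constantCoeff L₀ ≠ 0 := fun h0 => hL0Q0 (by rw [h0, PadicInt.coe_zero])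
  have hfE00 : PowerSeries.constantCoeff fE ≠ 0 := by
    intro h0
    have h' := congrArg PowerSeries.constantCoeff hrel
    simp only [map_mul, PowerSeries.constantCoeff_C, h0, mul_zero] at h'
    refine (mul_ne_zero (pow_ne_zero _ ?_) (mul_ne_zero ?_ hL00)) h'.symm
    · exact_mod_cast (two_ne_zero : (2 : ℕ) ≠ 0)
    · exact_mod_cast ϖ.den_nz
  have hfE0 : fE ≠ 0 := fun h => hfE00 (by rw [h, map_zero])
  have hSelfin : Finite (W.selmerGroupPInfty 2) :=
    D.finite_selmerGroupPInfty_of_constantCoeff_ne_zero W hγ hX fE hchar hfE00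
  obtain ⟨hEfin, hShapfin⟩ := (W.finite_selmerGroupPInfty_iff 2).mp hSelfin
  haveI := hEfin; haveI := hShapfin; haveI := hSelfin; haveI : Finite W.sha := hfin
  -- Step 4 (Greenberg's Thm. 4.1 AT 2 — the hypothesis `hEC`, slot `δ = 0` — for the generator `fE`)
  obtain ⟨u₁, hu₁⟩ := hEC hord κ γ hκ hγ hγ' D hX fE hchar hSelfin
  rw [add_zero, zpow_natCast] at hu₁
  obtain ⟨u₄, hu₄⟩ := exists_unit_torsionOrder_eq W 2
  obtain ⟨u₅, hu₅⟩ := exists_unit_natCard_eq_mul_card_primaryComponent W.sha 2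
  have hSel : Nat.card (W.selmerGroupPInfty 2) = Nat.card (AddCommGroup.primaryComponent W.sha 2) :=
    W.natCard_selmerGroupPInfty_eq_natCard_primaryComponent_sha 2
  set v := padicValNat 2 W.tamagawaProduct with hv
  set Tp : ℚ_[2] := (Nat.card (AddCommGroup.primaryComponent W.toAffine.Point 2) : ℚ_[2]) with hTp
  set Shp : ℚ_[2] := (Nat.card (AddCommGroup.primaryComponent W.sha 2) : ℚ_[2]) with hShp
  have hu₄' : (W.torsionOrder : ℚ_[2]) = ((u₄ : ℤ_[2]) : ℚ_[2]) * Tp := by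
    rw [hu₄, hTp]
    congr 1
    exact_mod_cast natCard_primaryComponent_point_congr W 2 _ _
  have hSha : (W.shaOrder : ℚ_[2]) = ((u₅ : ℤ_[2]) : ℚ_[2]) * Shp := by
    rw [WeierstrassCurve.shaOrder, hShp]
    exact hu₅
  have hSel' : (Nat.card (W.selmerGroupPInfty 2) : ℚ_[2]) = Shp := by rw [hShp, hSel]
  rw [hSel'] at hu₁
  have hTp0 : Tp ≠ 0 := by rw [hTp]; exact_mod_cast Nat.card_pos.ne'
  have hShp0 : Shp ≠ 0 := by rw [hShp]; exact_mod_cast Nat.card_pos.ne'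
  have hv2 : (2 : ℚ_[2]).valuation = 1 := by
    have h2 : ((2 : ℕ) : ℚ_[2]).valuation = 1 := Padic.valuation_p
    rwa [Nat.cast_ofNat] at h2
  have hvT : Tp.valuation = (padicValNat 2 W.torsionOrder : ℤ) := by
    have h := congrArg Padic.valuation hu₄'
    rw [Padic.valuation_natCast, Padic.valuation_mul (coe_units_ne_zero 2 u₄) hTp0,
      valuation_coe_units_eq_zero, zero_add] at h
    exact h.symm
  have hvS : Shp.valuation = (padicValNat 2 W.shaOrder : ℤ) := by
    have h := congrArg Padic.valuation hSha
    rw [Padic.valuation_natCast, Padic.valuation_mul (coe_units_ne_zero 2 u₅) hShp0,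
      valuation_coe_units_eq_zero, zero_add] at h
    exact h.symm
  have hvalL : (((PowerSeries.constantCoeff L₀ : ℤ_[2]) : ℚ_[2])).valuation =
      padicValRat 2 ϖ + padicValRat 2 s + 2 * Np.valuation := by
    rw [hL0, h1, Padic.valuation_mul (mul_ne_zero hϖQ0 (pow_ne_zero 2 (mul_ne_zero hU0 hNp0))) hsQ0,
      Padic.valuation_mul hϖQ0 (pow_ne_zero 2 (mul_ne_zero hU0 hNp0)), Padic.valuation_pow,
      Padic.valuation_mul hU0 hNp0,
      Padic.valuation_mul (coe_units_ne_zero 2 u₂) (coe_units_ne_zero 2 u₃),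
      valuation_coe_units_eq_zero, valuation_coe_units_eq_zero, Padic.valuation_ratCast,
      Padic.valuation_ratCast]
    push_cast
    ring
  have hfEQ0 : ((PowerSeries.constantCoeff fE : ℤ_[2]) : ℚ_[2]) ≠ 0 := by
    intro h0
    exact hfE00 (PadicInt.coe_eq_zero.mp h0)
  have hvalF : (((PowerSeries.constantCoeff fE : ℤ_[2]) : ℚ_[2])).valuation + 2 * Tp.valuation =
      v + 2 * Np.valuation + Shp.valuation := by
    have h := congrArg Padic.valuation hu₁
    rw [Padic.valuation_mul hfEQ0 (pow_ne_zero 2 hTp0), Padic.valuation_pow,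
      Padic.valuation_mul (mul_ne_zero (mul_ne_zero (coe_units_ne_zero 2 u₁) (pow_ne_zero v h20))
        (pow_ne_zero 2 hNp0)) hShp0,
      Padic.valuation_mul (mul_ne_zero (coe_units_ne_zero 2 u₁) (pow_ne_zero v h20))
        (pow_ne_zero 2 hNp0),
      Padic.valuation_mul (coe_units_ne_zero 2 u₁) (pow_ne_zero v h20), valuation_coe_units_eq_zero,
      Padic.valuation_pow, Padic.valuation_pow, hv2] at h
    push_cast at h ⊢
    linarith
  have hvaleq : (((PowerSeries.constantCoeff L₀ : ℤ_[2]) : ℚ_[2])).valuation =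
      (((PowerSeries.constantCoeff fE : ℤ_[2]) : ℚ_[2])).valuation := by
    rw [hvT, hvS] at hvalF
    rw [hvalL]
    have : padicValRat 2 ϖ + padicValRat 2 s = padicValRat 2 t := hvt.symm
    linarith
  have hnorm : ‖PowerSeries.constantCoeff L₀‖ = ‖PowerSeries.constantCoeff fE‖ := by
    rw [PadicInt.norm_def, PadicInt.norm_def, Padic.norm_eq_zpow_neg_valuation hL0Q0,
      Padic.norm_eq_zpow_neg_valuation hfEQ0, hvaleq]
  have hlamfE : lam fE = D.lambda := lam_generator_eq_lambdaInvariant D.X hX hfE0 hchar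
  exact charIdeal_eq_span_of_kato_of_lam_eq_of_norm_constantCoeff_eq W h17 hκ hγ hγ' hord hf D hchar
    hϖ0 hL₀ (hlam.trans hlamfE.symm) hfE00 hnorm

end Curve

end Summit.BirchSwinnertonDyer.BirchSwinnertonDyer.Theorems.LambdaConstPinch

end
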